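import Summits.AnomalousDissipation.AnomalousDissipation.Theorems.EnsembleRigidityGPTameDefectFloorRegionTools2
import Summits.AnomalousDissipation.AnomalousDissipation.Theorems.EnsembleRigidityGPTameDefectFloorParityForm3
import HarnessLib

/-!
# Tools stub `stub_gpTameRegionTools3` of line `Sketch` (crux stmt-AnomalousDissipation-17938,
# `EnsembleRigidity.GPTameDefectFloor`) — THE PROVED REGION `G₁ < 150/7` AND THE REDUCTION

Third layer of the proved region of T = TAME DEFECT FLOOR OF `f_GP` (cycle 1, wave 3 of the line):

* `gpTameFloor_enstrophy150over7` — T at EVERY level `(E, G₁)` with `G₁ < 150/7 ≈ 21.43` (any `E`): the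
  linear floor (`stub_linearFloor`) fed with the potential-table enstrophy certificate `w = f_GP`,
  `∫ (v ⊗ v) : ∇f_GP ≥ −(7/100) ‖∇v‖²` (`stub_gpParityForm3`: ratio weights `Φ(b)/Φ(a)` from an explicit
  integer potential on coefficient slots, budgets checked by `decide`), level condition
  `(7/100) max(G₁,0) < (f_GP, f_GP) = 3/2`. This extends `gpTameFloor_enstrophy18` (`G₁ < 18`),
  `gpTameFloor_smallEnstrophy` (`G₁ < 3√2·π`) and the tree\'s `G₁ < 3π`. Termwise schemes of this kind stop
  at `c₀ = 0.0618` (horizon `24.27`); the sharp constant is the energy-stability eigenvalue `0.0583`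
  (horizon `25.74`, numerics).
* `gpTameDefectFloor_of_certificatesHigh150over7` — THE REDUCTION: cylindrical certificates of the
  Farkas-dual shape at the normalised levels `(G₁/(4π²), G₁)`, `G₁ ≥ 150/7` (the open stub
  `stub_tameCertificatesHigh` of the line), imply `EnsembleRigidity.GPTameDefectFloor`.
* `stub_gpTameRegionTools3` — the registered conjunction.

## References

* C. Foias, O. Manley, R. Rosa, R. Temam, *Navier–Stokes Equations and Turbulence* (CUP 2001),
  Ch. IV §1.2.
* C. Doering, J. Gibbon, *Applied Analysis of the Navier–Stokes Equations* (CUP 1995), §2.2.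
-/

-- `Summit.<Summit>.<Problem>` is the tree's mandated summit-side namespace (CONVENTIONS §2); single-conjunct summit, duplicate deliberate.
set_option linter.dupNamespace false

noncomputable section

namespace Summit.AnomalousDissipation.AnomalousDissipation.Theorems.EnsembleRigidity.GPTameDefectFloor

open MeasureTheory Filter Topology UnitAddTorus
open scoped InnerProductSpace RealInnerProductSpace ENNReal NNReal
open Literature.Analysis.FunctionSpaces Literature.Analysis.FluidPDE
open Summit.AnomalousDissipation.AnomalousDissipation.Theorems.EnsembleRigidity

/-- Local notation: real vector fields on `T³`. -/
local notation "Vec3" => (UnitAddTorus (Fin 3)) → (EuclideanSpace ℝ (Fin 3))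
/-- Local notation: `L²(T³; ℝ³)`. -/
local notation "L2" => (Lp (EuclideanSpace ℝ (Fin 3)) 2 (volume : Measure (UnitAddTorus (Fin 3))))
/-- Local notation: the energy space `H`. -/
local notation "H3" => (Torus.energySpace (Fin 3))

/-- The potential-table bound of `f_GP` as a form bound on `H` (enstrophy certificate, `s_E = 0`,
`s_G = 7/100`). [folklore] -/
theorem region3_gpForce_enstrophyForm (v : H3) (hv : Torus.eGradNormSq ((v : L2) : Vec3) ≠ ⊤) :
    -(0 * ‖v‖ ^ 2 + 7 / 100 * (Torus.eGradNormSq ((v : L2) : Vec3)).toReal) ≤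
      Torus.inertialPairing (v : L2) gpForce := by
  have h := stub_gpParityForm3 v hv
  linarith

/-- **T below the potential-table enstrophy horizon `150/7`.** For `f = f_GP` and every level `(E, G₁)`
with `G₁ < 150/7` there is `r > 0` such that no probability measure on `H` with integrable energy `≤ E` and
mean enstrophy `≤ G₁` has Φ-uniform cylindrical forced-Euler defect `≤ r`. [folklore] -/
theorem gpTameFloor_enstrophy150over7 (f : Vec3) (hf : f = gpForce) (E G₁ : ℝ) (hG : G₁ < 150 / 7) :
    ∃ r : ℝ, 0 < r ∧ ∀ μ : Measure H3, IsProbabilityMeasure μ →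
      Integrable (fun v : H3 => ‖v‖ ^ 2) μ → Torus.ensembleEnergy μ ≤ E →
      Torus.ensembleEnstrophy μ ≤ ENNReal.ofReal G₁ →
      ¬ (∀ Φ : Torus.CylindricalTest (Fin 3),
        Integrable (fun v : H3 => Torus.nsGeneratorPairing 0 f v (Φ.grad v)) μ ∧
          |∫ v, Torus.nsGeneratorPairing 0 f v (Φ.grad v) ∂μ| ≤
            r * Real.sqrt (∫ v, Torus.gradNormSq (Φ.grad v) ∂μ)) := by
  obtain ⟨hsm, hdf, hzm⟩ := GPStatisticalRigidity.gpForce_admissible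
  have hff : ∫ x, ⟪f x, gpForce x⟫_ℝ = 3 / 2 := by
    rw [hf]
    exact GPStatisticalRigidity.gpForce_integral_inner_self
  refine stub_linearFloor f gpForce hf hsm hdf hzm 0 (7 / 100) le_rfl (by norm_num)
    region3_gpForce_enstrophyForm E G₁ ?_
  rw [hff, zero_mul, zero_add]
  have hmax : max G₁ 0 < 150 / 7 := max_lt hG (by norm_num)
  linarith

/-- **The reduction of line `Sketch` (third layer): cylindrical certificates above `G₁ = 150/7` ⇒ the
crux.** If for every `G₁ ≥ 150/7` the Galloway–Proctor force admits a cylindrical certificate of the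
Farkas-dual shape at the normalised level `(G₁/(4π²), G₁)`, then `EnsembleRigidity.GPTameDefectFloor`
holds: levels `G₁ < 150/7` by `gpTameFloor_enstrophy150over7`, levels `G₁ ≥ 150/7` by
`stub_tameWeakDuality` and `stub_energyIdle`. [folklore] -/
theorem gpTameDefectFloor_of_certificatesHigh150over7 (hHigh : ∀ f : Vec3, f = (fun x : UnitAddTorus (Fin 3) =>
      (Literature.Analysis.FluidPDE.Torus.stokesMode (Pi.single (2 : Fin 3) (1 : ℤ)) (EuclideanSpace.single (0 : Fin 3) (1 : ℝ)) false x +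
        Literature.Analysis.FluidPDE.Torus.stokesMode (Pi.single (0 : Fin 3) (1 : ℤ)) (EuclideanSpace.single (1 : Fin 3) (1 : ℝ)) false x +
        Literature.Analysis.FluidPDE.Torus.stokesMode (Pi.single (1 : Fin 3) (1 : ℤ)) (EuclideanSpace.single (2 : Fin 3) (1 : ℝ)) false x :
        EuclideanSpace ℝ (Fin 3))) →
      ∀ G₁ : ℝ, (150 / 7 : ℝ) ≤ G₁ →
        ∃ (Ψ : Torus.CylindricalTest (Fin 3)) (a b C Λ : ℝ), 0 ≤ b ∧ 0 < C ∧ 0 < Λ ∧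
          Λ⁻¹ * (1 + max G₁ 0) < a - b * (G₁ / (4 * Real.pi ^ 2)) ∧
          (∀ v : H3, Torus.gradNormSq (Ψ.grad v) ≤
            C ^ 2 * (1 + (Torus.eGradNormSq ((v : L2) : Vec3)).toReal)) ∧
          (∀ v : H3, Torus.eGradNormSq ((v : L2) : Vec3) ≠ ⊤ →
            a - b * ‖v‖ ^ 2 - Λ⁻¹ * (1 + (Torus.eGradNormSq ((v : L2) : Vec3)).toReal) ≤
              Torus.nsGeneratorPairing 0 f v (Ψ.grad v))) :
    Summit.AnomalousDissipation.AnomalousDissipation.Theses.EnsembleRigidity.GPTameDefectFloor := by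
  intro f hf E G₁
  have hf' : f = gpForce := hf.trans gpForce_eq.symm
  by_cases hG : G₁ < 150 / 7
  · exact gpTameFloor_enstrophy150over7 f hf' E G₁ hG
  · have hG' : (150 / 7 : ℝ) ≤ G₁ := not_lt.1 hG
    have hG0 : 0 ≤ G₁ := le_trans (by norm_num) hG'
    obtain ⟨Ψ, a, b, C, Λ, hb, hC, hΛ, hgap, hcost, hcert⟩ := hHigh f hf G₁ hG'
    obtain ⟨r, hr, hfloor⟩ := stub_tameWeakDuality f (G₁ / (4 * Real.pi ^ 2)) G₁
      ⟨Ψ, a, b, C, Λ, hb, hC, hΛ, hgap, hcost, hcert⟩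
    refine ⟨r, hr, stub_energyIdle f E G₁ r ?_⟩
    rw [max_eq_left hG0]
    exact hfloor

/-- **Tools stub `stub_gpTameRegionTools3`** (registered on stmt-AnomalousDissipation-17938): the proved
region `G₁ < 150/7` (any `E`) and the reduction of the crux to cylindrical certificates above `G₁ = 150/7`
(line `Sketch`, cycle 1 wave 3). [folklore] -/
theorem stub_gpTameRegionTools3 : (∀ f : Vec3, f = gpForce → ∀ E G₁ : ℝ, G₁ < 150 / 7 → ∃ r : ℝ, 0 < r ∧ ∀ μ : Measure H3, IsProbabilityMeasure μ → Integrable (fun v : H3 => ‖v‖ ^ 2) μ → Torus.ensembleEnergy μ ≤ E → Torus.ensembleEnstrophy μ ≤ ENNReal.ofReal G₁ → ¬ (∀ Φ : Torus.CylindricalTest (Fin 3), Integrable (fun v : H3 => Torus.nsGeneratorPairing 0 f v (Φ.grad v)) μ ∧ |∫ v, Torus.nsGeneratorPairing 0 f v (Φ.grad v) ∂μ| ≤ r * Real.sqrt (∫ v, Torus.gradNormSq (Φ.grad v) ∂μ))) ∧ ((∀ f : Vec3, f = (fun x : UnitAddTorus (Fin 3) => (Literature.Analysis.FluidPDE.Torus.stokesMode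 (Pi.single (2 : Fin 3) (1 : ℤ)) (EuclideanSpace.single (0 : Fin 3) (1 : ℝ)) false x + Literature.Analysis.FluidPDE.Torus.stokesMode (Pi.single (0 : Fin 3) (1 : ℤ)) (EuclideanSpace.single (1 : Fin 3) (1 : ℝ)) false x + Literature.Analysis.FluidPDE.Torus.stokesMode (Pi.single (1 : Fin 3) (1 : ℤ)) (EuclideanSpace.single (2 : Fin 3) (1 : ℝ)) false x : EuclideanSpace ℝ (Fin 3))) → ∀ G₁ : ℝ, (150 / 7 : ℝ) ≤ G₁ → ∃ (Ψ : Torus.CylindricalTest (Fin 3)) (a b C Λ : ℝ), 0 ≤ b ∧ 0 < C ∧ 0 < Λ ∧ Λ⁻¹ * (1 + max G₁ 0) < a - b * (G₁ / (4 * Real.pi ^ 2)) ∧ (∀ v : H3, Torus.gradNormSq (Ψ.grad v) ≤ C ^ 2 * (1 + (Torus.eGradNormSq ((v : L2) : Vec3)).toReal)) ∧ (∀ v : H3, Torus.eGradNormSq ((v : L2) : Vec3) ≠ ⊤ → a - b * ‖v‖ ^ 2 - Λ⁻¹ * (1 + (Torus.eGradNormSq ((v : L2) : Vec3)).toReal)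 ≤ Torus.nsGeneratorPairing 0 f v (Ψ.grad v))) → Summit.AnomalousDissipation.AnomalousDissipation.Theses.EnsembleRigidity.GPTameDefectFloor) :=
  ⟨gpTameFloor_enstrophy150over7, gpTameDefectFloor_of_certificatesHigh150over7⟩

end Summit.AnomalousDissipation.AnomalousDissipation.Theorems.EnsembleRigidity.GPTameDefectFloor

end
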